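import Literature.MathematicalPhysics.QuantumLattice.SpinFlipTwist
import Literature.MathematicalPhysics.QuantumLattice.InfiniteVolumeShiftProofs
import HarnessLib

/-!
# Spin-flip covariance of infinite-volume ground states; a unique ground state is flip invariant

Trunk **T-QLATTICE**. Proof file behind the named fact
`Literature.MathematicalPhysics.QuantumLattice.no_unique_gapped_groundState_halfOddSpin`
(`InfiniteVolume.lean`). The Affleck–Lieb argument uses, besides translation invariance
(`InfiniteVolumeShiftProofs.lean`), the `ℤ₂` symmetry of the Heisenberg chain — the `π`-rotation
about the `x`-axis, here the spin flip `flipOp n` of `SpinFlipTwist.lean` (`Sᶻ ↦ -Sᶻ`) — through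
the statement "the (global) uniqueness implies … `ω(Ŝᶻ) = 0`" (Tasaki 2022, before Cor. 3.6),
i.e. the unique ground state is invariant under the flip. This file records, for a general
interaction `Φ` on `ℤ^d` with flip-invariant terms (`∀ Y, flip (Φ Y) = Φ Y`):

* `flipOp_embedOp`, `flipOp_localHamiltonian_restrict`, `flipOp_derivation` — the flip commutes
  with isotony, fixes the local Hamiltonians `H_S = Σ_{Y ⊆ S} Φ Y` and commutes with the
  generator, `flip (δ_Λ(A)) = δ_Λ(flip A)`;
* `InfVolState.exists_flip` — the flipped family `Λ ↦ ω_Λ ∘ flip` is again an infinite-volume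
  state (normalised, positive, compatible), and `InfVolState.IsGroundState.of_expect_eq_flipOp` —
  it is a ground state when `ω` is (Bratteli–Robinson II §6.2.7 / Prop. 5.3.19: the ground states
  of a symmetric interaction form an invariant set);
* `HasUniqueGroundState.expect_flipOp` — **a unique ground state is flip invariant**,
  `ω_Λ(flip A) = ω_Λ(A)` for all local `A` (Tasaki 2022, before Cor. 3.6; Affleck–Lieb 1986 §2);
* `flipOp_heisenbergInteraction` — the Heisenberg chain interaction `J 𝐒_x·𝐒_{x+1}` is flip
  invariant (`flipOp_spinDot`), so all of the above applies to `heisenbergInteraction n J`.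

No statement of any other file is changed and no definition is introduced (the flipped state is
produced by an existence statement, `InfVolState.exists_flip`).

## References

* H. Tasaki, *The Lieb–Schultz–Mattis theorem. A topological point of view*, in: The Physics
  and Mathematics of Elliott Lieb, vol. 2, EMS Press (2022) 405–446, arXiv:2202.06243 (held), §3,
  paragraph before Cor. 3.6 (uniqueness ⇒ invariance under `U(1) ⋊ ℤ₂` and translations).
  [Tasaki2022]
* I. Affleck, E. H. Lieb, *A proof of part of Haldane's conjecture on spin chains*,
  Lett. Math. Phys. 12 (1986) 57–69, §2. [AffleckLieb1986]
* O. Bratteli, D. W. Robinson, *Operator Algebras and Quantum Statistical Mechanics 2*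
  (2nd ed., Springer 1997), Prop. 5.3.19 and §6.2.7 (ground states; invariance under symmetries
  of the dynamics). [BratteliRobinsonII1997]
-/

noncomputable section

open Matrix Complex Finset
open scoped ComplexOrder

namespace Literature.MathematicalPhysics.QuantumLattice

open Literature.Probability.LatticeModels
open Literature.Probability.LatticeModels (Site)

variable {d : ℕ} (n : ℕ)

/-! ### The flip commutes with isotony, the local Hamiltonians and the generator -/

/-- **The spin flip commutes with isotony**: `flip (A ⊗ 𝟙_{Λ'∖Λ}) = flip(A) ⊗ 𝟙_{Λ'∖Λ}` (the flip
acts site-wise). Bratteli–Robinson II §6.2.1. [folklore] -/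
theorem flipOp_embedOp {Λ Λ' : Finset (Site d)} (h : Λ ⊆ Λ') (A : Op ↥Λ (n + 1)) :
    flipOp n (embedOp h A) = embedOp h (flipOp n A) := by
  ext σ τ
  simp only [flipOp_apply, embedOp, of_apply, Fin.rev_inj]

/-- For an interaction with flip-invariant terms, the local Hamiltonians `H_S = Σ_{Y ⊆ S} Φ Y ⊗ 𝟙`
are flip invariant. Bratteli–Robinson II §6.2.1, eq. (6.2.4). [folklore] -/
theorem flipOp_localHamiltonian_restrict {Φ : LatticeInteraction d (n + 1)}
    (hΦ : ∀ Y, flipOp n (Φ Y) = Φ Y) (S : Finset (Site d)) :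
    flipOp n (localHamiltonian (Φ.restrict S) univ) = localHamiltonian (Φ.restrict S) univ := by
  rw [localHamiltonian_restrict_eq_sum, map_sum]
  refine Finset.sum_congr rfl fun Y hY => ?_
  rw [dif_pos (mem_powerset.1 hY), flipOp_embedOp, hΦ]

/-- **The flip commutes with the generator**: `flip (δ_Λ(A)) = δ_Λ(flip A)` for an interaction with
flip-invariant terms (`δ_Λ = i[H_{Λ_R}, · ⊗ 𝟙]` and `flip` is an algebra automorphism fixing
`H_{Λ_R}`). Bratteli–Robinson II Thm. 6.2.4 / §6.2.7 (symmetries of `Φ` commute with the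
dynamics). [folklore] -/
theorem flipOp_derivation {Φ : LatticeInteraction d (n + 1)} (hΦ : ∀ Y, flipOp n (Φ Y) = Φ Y)
    (R : ℝ) (Λ : Finset (Site d)) (A : Op ↥Λ (n + 1)) :
    flipOp n (derivation Φ R Λ A) = derivation Φ R Λ (flipOp n A) := by
  rw [derivation, derivation, map_smul, map_sub, map_mul, map_mul,
    flipOp_localHamiltonian_restrict n hΦ, flipOp_embedOp]

/-! ### The flipped state; flip covariance of ground states -/

/-- **The flipped state.** For every infinite-volume state `ω` there is an infinite-volume state
`ω ∘ flip` with local expectations `A ↦ ω_Λ(flip A)`: normalisation (`flip 𝟙 = 𝟙`), positivity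
(`flip (AᴴA) = (flip A)ᴴ(flip A)`) and compatibility (`flipOp_embedOp`) are inherited. This is the
state `ω ∘ α` for the automorphism `α = flip` of the quasi-local algebra (Bratteli–Robinson II
§6.2.1; the `ℤ₂` action of Tasaki 2022 §3). Stated as an existence result so that no definition is
introduced. [folklore] -/
theorem InfVolState.exists_flip (ω : InfVolState d (n + 1)) :
    ∃ ω' : InfVolState d (n + 1), ∀ (Λ : Finset (Site d)) (A : Op ↥Λ (n + 1)),
      ω'.expect Λ A = ω.expect Λ (flipOp n A) := by
  refine ⟨⟨fun Λ => ω.expect Λ ∘ₗ (flipOp n (Λ := ↥Λ)).toLinearMap, fun Λ => ?_, fun Λ A => ?_,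
    fun Λ Λ' h A => ?_⟩, fun Λ A => rfl⟩
  · simp only [LinearMap.coe_comp, Function.comp_apply, AlgEquiv.toLinearMap_apply, map_one]
    exact ω.expect_one Λ
  · simp only [LinearMap.coe_comp, Function.comp_apply, AlgEquiv.toLinearMap_apply, map_mul,
      flipOp_conjTranspose]
    exact ω.expect_nonneg Λ _
  · simp only [LinearMap.coe_comp, Function.comp_apply, AlgEquiv.toLinearMap_apply,
      flipOp_embedOp]
    exact ω.compatible h _

/-- **Flips of ground states are ground states.** If `Φ` has flip-invariant terms, `ω` is an
infinite-volume ground state and `ω'` is its flip (`ω'_Λ(A) = ω_Λ(flip A)`), then `ω'` is a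
ground state: `-i ω'(Aᴴ δ(A)) = -i ω((flip A)ᴴ δ(flip A)) ≥ 0`. Bratteli–Robinson II Prop. 5.3.19
and §6.2.7 (the set of ground states is invariant under the symmetries of the dynamics);
Tasaki (2022) §3. [cite: BratteliRobinsonII1997, §6.2.7] -/
theorem InfVolState.IsGroundState.of_expect_eq_flipOp {Φ : LatticeInteraction d (n + 1)}
    (hΦ : ∀ Y, flipOp n (Φ Y) = Φ Y) {R : ℝ} {ω ω' : InfVolState d (n + 1)}
    (hω : ω.IsGroundState Φ R)
    (hflip : ∀ (Λ : Finset (Site d)) (A : Op ↥Λ (n + 1)), ω'.expect Λ A = ω.expect Λ (flipOp n A)) :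
    ω'.IsGroundState Φ R := by
  intro Λ A
  rw [hflip, map_mul, flipOp_conjTranspose, flipOp_embedOp, flipOp_derivation n hΦ]
  exact hω Λ (flipOp n A)

/-- **A unique ground state is flip invariant**: if `Φ` has flip-invariant terms and a unique
infinite-volume ground state `ω`, then `ω_Λ(flip A) = ω_Λ(A)` for every local observable `A`
(the flipped state is a ground state, hence equal to `ω`). Tasaki (2022), paragraph before
Cor. 3.6 (uniqueness ⇒ invariance, whence `ω(Ŝᶻ) = 0`); Affleck–Lieb (1986) §2.
[cite: Tasaki2022, §3 (before Cor. 3.6)] -/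
theorem HasUniqueGroundState.expect_flipOp {Φ : LatticeInteraction d (n + 1)} {R : ℝ}
    (hU : HasUniqueGroundState Φ R) (hΦ : ∀ Y, flipOp n (Φ Y) = Φ Y) {ω : InfVolState d (n + 1)}
    (hω : ω ∈ groundStates Φ R) (Λ : Finset (Site d)) (A : Op ↥Λ (n + 1)) :
    ω.expect Λ (flipOp n A) = ω.expect Λ A := by
  obtain ⟨ω', hω'⟩ := InfVolState.exists_flip n ω
  obtain ⟨ω₀, -, huniq⟩ := hU
  have h' : ω' = ω :=
    (huniq ω' (InfVolState.IsGroundState.of_expect_eq_flipOp n hΦ hω hω')).trans (huniq ω hω).symm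
  rw [← hω', h']

/-! ### The Heisenberg chain is flip invariant -/

/-- **The Heisenberg chain interaction is flip invariant**: `flip (Φ Y) = Φ Y` for every region,
`Φ = heisenbergInteraction n J` (`Φ {x,x+1} = J 𝐒_x·𝐒_{x+1}`, and `flip (𝐒_x·𝐒_y) = 𝐒_x·𝐒_y`,
`flipOp_spinDot`): the `ℤ₂` part of the `U(1) ⋊ ℤ₂` symmetry of the chain (Tasaki 2022 §3;
Affleck–Lieb 1986). [cite: Tasaki2022, §3 (before Cor. 3.6)] -/
theorem flipOp_heisenbergInteraction (J : ℝ) (Y : Finset (Site 1)) :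
    flipOp n (heisenbergInteraction n J Y) = heisenbergInteraction n J Y := by
  rw [heisenbergInteraction_apply]
  split_ifs
  · rw [map_smul, map_sum]
    congr 1
    refine Finset.sum_congr rfl fun x _ => ?_
    rw [map_sum]
    refine Finset.sum_congr rfl fun y _ => ?_
    split_ifs
    · exact flipOp_spinDot n x y
    · exact map_zero _
  · exact map_zero _

/-- For the Heisenberg chain, a unique infinite-volume ground state is flip invariant:
`ω_Λ(flip A) = ω_Λ(A)`. Tasaki (2022), paragraph before Cor. 3.6. [cite: Tasaki2022, §3 (before Cor. 3.6)] -/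
theorem HasUniqueGroundState.expect_flipOp_heisenberg {J : ℝ}
    (hU : HasUniqueGroundState (heisenbergInteraction n J) 1) {ω : InfVolState 1 (n + 1)}
    (hω : ω ∈ groundStates (heisenbergInteraction n J) 1) (Λ : Finset (Site 1))
    (A : Op ↥Λ (n + 1)) : ω.expect Λ (flipOp n A) = ω.expect Λ A :=
  hU.expect_flipOp n (flipOp_heisenbergInteraction n J) hω Λ A

/-- For the Heisenberg chain, a unique infinite-volume ground state is translation invariant on
local observables: `ω_{Λ+v}(τ_v A) = ω_Λ(A)` (`isTranslationInvariant_heisenbergInteraction_holds`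
and `HasUniqueGroundState.expect_map_shift_transportOp`). Tasaki (2022), paragraph before
Cor. 3.6. [cite: Tasaki2022, §3 (before Cor. 3.6)] -/
theorem HasUniqueGroundState.expect_shift_heisenberg {J : ℝ}
    (hU : HasUniqueGroundState (heisenbergInteraction n J) 1) {ω : InfVolState 1 (n + 1)}
    (hω : ω ∈ groundStates (heisenbergInteraction n J) 1) (v : Site 1) (Λ : Finset (Site 1))
    (A : Op ↥Λ (n + 1)) :
    ω.expect (Λ.map (Site.shift v).toEmbedding)
        (transportOp (finsetMapEquiv (Site.shift v).toEmbedding Λ) A) = ω.expect Λ A :=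
  hU.expect_map_shift_transportOp (isTranslationInvariant_heisenbergInteraction_holds n J) hω v Λ A

end Literature.MathematicalPhysics.QuantumLattice
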